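import Mathlib
import HarnessLib
import Summits.HubbardSuperconductivity.HubbardSuperconductivity.Theorems.KLProgrammeKLRegimeTwoVolumeSourceProfileDefs
import Summits.HubbardSuperconductivity.HubbardSuperconductivity.Theorems.KLProgrammeKLRegimeTwoVolumeProfileBridge
import Summits.HubbardSuperconductivity.HubbardSuperconductivity.Theorems.KLProgrammeKLRegimeEngineE4ScaleDoor

/-!
# Route `KLProgramme` — crux K3, VL child `KLRegimeVolumeLimitV17F2` (stmt-HubbardSuperconductivity-20440), blueprint v5 M3b kit: ONE-VOLUME DATA CONVERSIONS
# FOR THE Λ-SCALED TWO-VOLUME STEP (seat hubbard-kl-k3c4-p1 g12; `--supports` stmt-…-20440)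

`…TwoVolumeSrcSectorScaleSuccWt.srcSector_sum_norm_kernel_twoVolume_scaleSucc_wt_le` (M3d-wt) reads its one-volume data in the currency «distance =
`Λ · tnorm` of the sites», regions = integer tnorm-balls.  The engine exports `klScaleWt … r`-weighted quantities (`klScaleWt L M β r S = 1 + Λ_r·diam_d S`,
`d = gridLabelDist L (4M) β` on the `4M`-grid positions, time AND space; `…EngineE4ScaleDoor`).  This file is the dictionary (`Λ ≤ Λ_r`, `0 ≤ β`):

* §1 **weights**: `tnorm(x⃗_X − x⃗_Y) ≤ gridLabelDist (latticeLegPos X) (latticeLegPos Y)`; `1 + Λ·tnorm ≤ klScaleWt … r {pos X, pos Y}` (pairs, sector legs and doubled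
  legs); `1 + labelDiam (Λ·tnorm) (univ.image Y) ≤ klScaleWt … r ((univ.image Y).image pos)` (tuples) — every weighted profile / weighted row hypothesis of M3d-wt
  is dominated termwise by its `klScaleWt`-currency twin;
* §2 **Markov tails at rate Λ**: `Σ_{a : R < w a} f a ≤ (1 + Λ(R+1))⁻¹ · Σ_a (1 + Λ·w a)·f a` and its row forms — the far row tail `T`, the fibre tails `Te ≤ T`,
  the transfer tails `τT` of M3d-wt from ONE scaled weighted row/column bound;
* §3 **profiles**: the plain pinned profile is at most the weighted one; the far pinned profile (a leg at tnorm-distance `> D` from the pin) is at most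
  `(1 + Λ(D+1))⁻¹ ×` the weighted one (pair distance ≤ diameter).

Pure bookkeeping; proofs only; no definition; nothing about the model is asserted.  Reference for the role: BGM 2006 §3 (3.2)–(3.8).
-/

noncomputable section

namespace Summit.HubbardSuperconductivity.HubbardSuperconductivity.Theorems.TwoVolumeDefect

set_option linter.dupNamespace false -- summit = problem name (single-conjunct summit), D-0017

open Finset Literature.MathematicalPhysics.QuantumLattice GrassmannAlgebra Literature.Probability.LatticeModels
  Literature.Probability.LatticeModels.BattleFederbush
open Summit.HubbardSuperconductivity.HubbardSuperconductivity.Theorems.EngineV8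
open Summit.HubbardSuperconductivity.HubbardSuperconductivity.Theorems.KLRegimeSplit
open Summit.HubbardSuperconductivity.HubbardSuperconductivity.Theorems.KLProgrammeLegKernels
open Summit.HubbardSuperconductivity.HubbardSuperconductivity.Theorems.TwoVolumeSource

/-! ## §1 Scaled site distances against the engine's tree weight -/

section Weights

variable {L M Ns : ℕ} [NeZero L]

/-- **The site torus distance of two sector-field legs is dominated by the engine's label distance of their positions** (`0 ≤ β`). [folklore] -/
theorem tnorm_sub_le_gridLabelDist_latticeLegPos {β : ℝ} (hβ : 0 ≤ β) (X Y : SpaceTimeIdx L M × SectorLeg Ns) :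
    (Torus.tnorm (X.1.2 - Y.1.2) : ℝ) ≤ gridLabelDist L (2 * (2 * M)) β (latticeLegPos (2 * (2 * M)) X) (latticeLegPos (2 * (2 * M)) Y) := by
  rw [gridLabelDist_apply, latticeLegPos_apply, latticeLegPos_apply, tnorm_sub_eq_torusSiteDist]
  dsimp only
  have hc : 0 ≤ cyclicDist (2 * (2 * M)) (((2 * (X.1.1 : ℕ) : ℕ) : ZMod (2 * (2 * M)))) (((2 * (Y.1.1 : ℕ) : ℕ) : ZMod (2 * (2 * M)))) := by
    unfold cyclicDist; positivity
  have hb : 0 ≤ β / (2 * (2 * M) : ℕ) * cyclicDist (2 * (2 * M)) (((2 * (X.1.1 : ℕ) : ℕ) : ZMod (2 * (2 * M))))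
      (((2 * (Y.1.1 : ℕ) : ℕ) : ZMod (2 * (2 * M)))) := mul_nonneg (by positivity) hc
  linarith

/-- **Scaled pair weight ≤ `klScaleWt`**: `1 + Λ·tnorm(x⃗_X − x⃗_Y) ≤ klScaleWt L M β r {pos X, pos Y}` for `0 ≤ Λ ≤ Λ_r`, `0 ≤ β`. [folklore] -/
theorem one_add_mul_tnorm_le_klScaleWt_pair [NeZero M] {β : ℝ} (hβ : 0 ≤ β) {Λ : ℝ} {r : ℕ} (hΛr : Λ ≤ klScale klE0 r)
    (X Y : SpaceTimeIdx L M × SectorLeg Ns) :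
    1 + Λ * (Torus.tnorm (X.1.2 - Y.1.2) : ℝ) ≤ klScaleWt L M β r {latticeLegPos (2 * (2 * M)) X, latticeLegPos (2 * (2 * M)) Y} := by
  classical
  rw [klScaleWt_apply]
  have ht : (0 : ℝ) ≤ Torus.tnorm (X.1.2 - Y.1.2) := Nat.cast_nonneg _
  have hd : (Torus.tnorm (X.1.2 - Y.1.2) : ℝ) ≤ labelDiam (gridLabelDist L (2 * (2 * M)) β) {latticeLegPos (2 * (2 * M)) X, latticeLegPos (2 * (2 * M)) Y} :=
    (tnorm_sub_le_gridLabelDist_latticeLegPos hβ X Y).trans (le_labelDiam _ (by simp) (by simp))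
  nlinarith [mul_le_mul hΛr hd ht (klth_klScale_pos r).le]

/-- **Scaled tuple weight ≤ `klScaleWt`** (sector-field legs): `1 + labelDiam (Λ·tnorm) (univ.image Y) ≤ klScaleWt L M β r ((univ.image Y).image pos)`. [folklore] -/
theorem one_add_labelDiam_mul_tnorm_le_klScaleWt [NeZero M] {β : ℝ} (hβ : 0 ≤ β) {Λ : ℝ} {r : ℕ} (hΛr : Λ ≤ klScale klE0 r)
    {ι : Type*} [Fintype ι] [DecidableEq ι] (Y : ι → SpaceTimeIdx L M × SectorLeg Ns) :
    1 + labelDiam (fun Y₁ Y₂ : SpaceTimeIdx L M × SectorLeg Ns => Λ * (Torus.tnorm (Y₁.1.2 - Y₂.1.2) : ℝ)) (univ.image Y) ≤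
      klScaleWt L M β r ((univ.image Y).image (latticeLegPos (2 * (2 * M)))) := by
  classical
  rw [klScaleWt_apply]
  refine add_le_add_right ?_ 1
  refine labelDiam_le _ (mul_nonneg (klth_klScale_pos r).le (labelDiam_nonneg _ _)) fun a ha b hb => ?_
  have ht : (0 : ℝ) ≤ Torus.tnorm (a.1.2 - b.1.2) := Nat.cast_nonneg _
  have hd : (Torus.tnorm (a.1.2 - b.1.2) : ℝ) ≤ labelDiam (gridLabelDist L (2 * (2 * M)) β) ((univ.image Y).image (latticeLegPos (2 * (2 * M)))) :=
    (tnorm_sub_le_gridLabelDist_latticeLegPos hβ a b).trans (le_labelDiam _ (mem_image_of_mem _ ha) (mem_image_of_mem _ hb))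
  exact mul_le_mul hΛr hd ht (klth_klScale_pos r).le

/-- **Scaled pair weight ≤ `klScaleWt`, doubled legs** (positions through `srcLegPos = latticeLegPos ∘ fst`). [folklore] -/
theorem one_add_mul_tnorm_le_klScaleWt_pair_src [NeZero M] {β : ℝ} (hβ : 0 ≤ β) {Λ : ℝ} {r : ℕ} (hΛr : Λ ≤ klScale klE0 r)
    (X Y : (SpaceTimeIdx L M × SectorLeg Ns) × Fin 2) :
    1 + Λ * (Torus.tnorm (X.1.1.2 - Y.1.1.2) : ℝ) ≤ klScaleWt L M β r {srcLegPos L M (2 * (2 * M)) X, srcLegPos L M (2 * (2 * M)) Y} :=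
  one_add_mul_tnorm_le_klScaleWt_pair hβ hΛr X.1 Y.1

/-- **Scaled tuple weight ≤ `klScaleWt`, doubled legs.** [folklore] -/
theorem one_add_labelDiam_mul_tnorm_le_klScaleWt_src [NeZero M] {β : ℝ} (hβ : 0 ≤ β) {Λ : ℝ} {r : ℕ} (hΛr : Λ ≤ klScale klE0 r)
    {ι : Type*} [Fintype ι] [DecidableEq ι] (Y : ι → (SpaceTimeIdx L M × SectorLeg Ns) × Fin 2) :
    1 + labelDiam (fun Y₁ Y₂ : (SpaceTimeIdx L M × SectorLeg Ns) × Fin 2 => Λ * (Torus.tnorm (Y₁.1.1.2 - Y₂.1.1.2) : ℝ)) (univ.image Y) ≤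
      klScaleWt L M β r ((univ.image Y).image (srcLegPos L M (2 * (2 * M)))) := by
  classical
  rw [klScaleWt_apply]
  refine add_le_add_right ?_ 1
  refine labelDiam_le _ (mul_nonneg (klth_klScale_pos r).le (labelDiam_nonneg _ _)) fun a ha b hb => ?_
  have ht : (0 : ℝ) ≤ Torus.tnorm (a.1.1.2 - b.1.1.2) := Nat.cast_nonneg _
  have hd : (Torus.tnorm (a.1.1.2 - b.1.1.2) : ℝ) ≤ labelDiam (gridLabelDist L (2 * (2 * M)) β) ((univ.image Y).image (srcLegPos L M (2 * (2 * M)))) :=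
    (tnorm_sub_le_gridLabelDist_latticeLegPos hβ a.1 b.1).trans (le_labelDiam _ (mem_image_of_mem _ ha) (mem_image_of_mem _ hb))
  exact mul_le_mul hΛr hd ht (klth_klScale_pos r).le

/-- **A weighted sum dominates termwise**: if `0 ≤ f`, `w ≤ w′` pointwise on `s`, then `Σ f·w ≤ B ⟸ Σ f·w′ ≤ B`. [folklore] -/
theorem sum_mul_le_of_sum_mul_le_of_le {α : Type*} (s : Finset α) (f w w' : α → ℝ) (hf : ∀ a ∈ s, 0 ≤ f a) (hw : ∀ a ∈ s, w a ≤ w' a) {B : ℝ}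
    (h : ∑ a ∈ s, f a * w' a ≤ B) : ∑ a ∈ s, f a * w a ≤ B :=
  (sum_le_sum fun a ha => mul_le_mul_of_nonneg_left (hw a ha) (hf a ha)).trans h

end Weights

/-! ## §2 Markov tails at rate `Λ` -/

section Tails

/-- **Markov at rate `Λ`**: `Σ_{a ∈ s : R < w a} f a ≤ (1 + Λ(R+1))⁻¹ · Σ_{a ∈ s} f a · (1 + Λ·w a)` for `f ≥ 0`, `Λ ≥ 0`, integer `w`. [folklore] -/
theorem sum_filter_lt_le_inv_mul_sum_scaled {α : Type*} (s : Finset α) (f : α → ℝ) (w : α → ℕ) (hf : ∀ a ∈ s, 0 ≤ f a) {Λ : ℝ} (hΛ : 0 ≤ Λ) (R : ℕ) :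
    ∑ a ∈ s.filter (fun a => R < w a), f a ≤ (1 + Λ * ((R : ℝ) + 1))⁻¹ * ∑ a ∈ s, f a * (1 + Λ * (w a : ℝ)) := by
  have hR : (0 : ℝ) < 1 + Λ * ((R : ℝ) + 1) := by positivity
  rw [mul_sum]
  calc ∑ a ∈ s.filter (fun a => R < w a), f a ≤ ∑ a ∈ s.filter (fun a => R < w a), (1 + Λ * ((R : ℝ) + 1))⁻¹ * (f a * (1 + Λ * (w a : ℝ))) := by
        refine sum_le_sum fun a ha => ?_
        simp only [mem_filter] at ha
        have hw : (R : ℝ) + 1 ≤ w a := by exact_mod_cast Nat.succ_le_of_lt ha.2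
        have hw' : 1 + Λ * ((R : ℝ) + 1) ≤ 1 + Λ * (w a : ℝ) := by nlinarith
        rw [inv_mul_eq_div, le_div_iff₀ hR]
        exact mul_le_mul_of_nonneg_left hw' (hf a ha.1)
    _ ≤ ∑ a ∈ s, (1 + Λ * ((R : ℝ) + 1))⁻¹ * (f a * (1 + Λ * (w a : ℝ))) :=
        sum_le_sum_of_subset_of_nonneg (filter_subset _ _) fun a ha _ =>
          mul_nonneg (inv_nonneg.2 hR.le) (mul_nonneg (hf a ha) (by positivity))

/-- The same with the complement written as `¬ w a ≤ R`. [folklore] -/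
theorem sum_filter_not_le_le_inv_mul_sum_scaled {α : Type*} (s : Finset α) (f : α → ℝ) (w : α → ℕ) (hf : ∀ a ∈ s, 0 ≤ f a) {Λ : ℝ} (hΛ : 0 ≤ Λ) (R : ℕ) :
    ∑ a ∈ s.filter (fun a => ¬ w a ≤ R), f a ≤ (1 + Λ * ((R : ℝ) + 1))⁻¹ * ∑ a ∈ s, f a * (1 + Λ * (w a : ℝ)) := by
  have h := sum_filter_lt_le_inv_mul_sum_scaled s f w hf hΛ R
  have hs : s.filter (fun a => ¬ w a ≤ R) = s.filter (fun a => R < w a) := filter_congr fun a _ => by simp only [not_le]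
  rwa [hs]

/-- **The far row tail from a scaled weighted row**: `Σ_{Y : R < tnorm(x⃗_X − x⃗_Y)} ‖C X Y‖ ≤ αw/(1 + Λ(R+1))` whenever
`Σ_Y ‖C X Y‖·(1 + Λ·tnorm(x⃗_X − x⃗_Y)) ≤ αw` (any finite label type, any site map). [folklore] -/
theorem sum_far_norm_le_of_scaledRow {Γ : Type*} [Fintype Γ] {V : ℕ} (site : Γ → TorusSite 2 V) (C : Matrix Γ Γ ℂ) {Λ : ℝ} (hΛ : 0 ≤ Λ) (R : ℕ) {αw : ℝ}
    (X : Γ) (hrow : ∑ Y, ‖C X Y‖ * (1 + Λ * (Torus.tnorm (site X - site Y) : ℝ)) ≤ αw) :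
    ∑ Y ∈ univ.filter (fun Y => R < Torus.tnorm (site X - site Y)), ‖C X Y‖ ≤ αw / (1 + Λ * ((R : ℝ) + 1)) := by
  have h := sum_filter_lt_le_inv_mul_sum_scaled univ (fun Y => ‖C X Y‖) (fun Y => Torus.tnorm (site X - site Y)) (fun _ _ => norm_nonneg _) hΛ R
  rw [div_eq_inv_mul]
  exact h.trans (mul_le_mul_of_nonneg_left hrow (inv_nonneg.2 (by positivity)))

/-- **A sub-tail is at most the tail**: restricting the far sum by any further predicate keeps the bound. [folklore] -/
theorem sum_filter_and_far_norm_le {Γ : Type*} [Fintype Γ] (C : Matrix Γ Γ ℂ) (Far : Γ → Prop) [DecidablePred Far] (P : Γ → Prop) [DecidablePred P]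
    (X : Γ) {T : ℝ} (hT : ∑ Y ∈ univ.filter (fun Y => Far Y), ‖C X Y‖ ≤ T) :
    ∑ Y ∈ univ.filter (fun Y => P Y ∧ Far Y), ‖C X Y‖ ≤ T := by
  refine le_trans (sum_le_sum_of_subset_of_nonneg (fun Y hY => ?_) fun _ _ _ => norm_nonneg _) hT
  simp only [mem_filter, mem_univ, true_and] at hY ⊢
  exact hY.2

/-- **A single entry is at most the (weighted) row sum.** [folklore] -/
theorem norm_le_of_scaledRow {Γ : Type*} [Fintype Γ] (C : Matrix Γ Γ ℂ) (wt : Γ → Γ → ℝ) (hwt : ∀ X Y, 1 ≤ wt X Y) {αw : ℝ} (X Y : Γ)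
    (hrow : ∑ Y', ‖C X Y'‖ * wt X Y' ≤ αw) : ‖C X Y‖ ≤ αw := by
  calc ‖C X Y‖ ≤ ‖C X Y‖ * wt X Y := le_mul_of_one_le_right (norm_nonneg _) (hwt X Y)
    _ ≤ ∑ Y', ‖C X Y'‖ * wt X Y' := single_le_sum (f := fun Y' => ‖C X Y'‖ * wt X Y') (fun Y' _ => mul_nonneg (norm_nonneg _) (zero_le_one.trans (hwt X Y')))
        (mem_univ Y)
    _ ≤ αw := hrow

/-- **The plain row sum is at most the weighted one** (weights `≥ 1`). [folklore] -/
theorem sum_norm_le_of_scaledRow {Γ Γ' : Type*} [Fintype Γ'] (C : Matrix Γ Γ' ℂ) (wt : Γ → Γ' → ℝ) (hwt : ∀ X Y, 1 ≤ wt X Y) {αw : ℝ} (X : Γ)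
    (hrow : ∑ Y, ‖C X Y‖ * wt X Y ≤ αw) : ∑ Y, ‖C X Y‖ ≤ αw :=
  (sum_le_sum fun Y _ => le_mul_of_one_le_right (norm_nonneg _) (hwt X Y)).trans hrow

/-- **The scaled first moment is at most the scaled weighted row** (`Σ‖C‖·Λd ≤ Σ‖C‖·(1+Λd)`). [folklore] -/
theorem sum_norm_mul_le_of_scaledRow {Γ Γ' : Type*} [Fintype Γ'] (C : Matrix Γ Γ' ℂ) (d : Γ → Γ' → ℝ) {αw : ℝ} (X : Γ)
    (hrow : ∑ Y, ‖C X Y‖ * (1 + d X Y) ≤ αw) : ∑ Y, ‖C X Y‖ * d X Y ≤ αw :=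
  (sum_le_sum fun Y _ => by nlinarith [norm_nonneg (C X Y)]).trans hrow

end Tails

/-! ## §3 Pinned profiles: plain ≤ weighted, far ≤ weighted / weight -/

section Profiles

variable {𝕜 : Type*} [RCLike 𝕜]

/-- **The plain pinned profile is at most the weighted one** (weights `≥ 1`). [folklore] -/
theorem sum_filter_norm_kernel_le_of_weighted {Γ : Type*} [Fintype Γ] [DecidableEq Γ] (W : GrassmannAlgebra 𝕜 Γ) (k : ℕ) (p : Fin k) (y : Γ)
    (wt : (Fin k → Γ) → ℝ) (hwt : ∀ Y, 1 ≤ wt Y) {N : ℝ}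
    (h : ∑ Y ∈ univ.filter (fun Y : Fin k → Γ => Y p = y), ‖kernel 𝕜 W k Y‖ * wt Y ≤ N) :
    ∑ Y ∈ univ.filter (fun Y : Fin k → Γ => Y p = y), ‖kernel 𝕜 W k Y‖ ≤ N :=
  (sum_le_sum fun Y _ => le_mul_of_one_le_right (norm_nonneg _) (hwt Y)).trans h

/-- **The far pinned profile from the scaled diameter-weighted profile**: strings pinned at `y` whose leg `i` sits at tnorm-distance `> D` from the pin have
total kernel mass `≤ (1 + Λ(D+1))⁻¹ · N` whenever the `(1 + labelDiam (Λ·tnorm))`-weighted pinned profile is `≤ N` (`Λ ≥ 0`). [folklore] -/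
theorem sum_far_norm_kernel_le_of_scaledWeighted {Γ : Type*} [Fintype Γ] [DecidableEq Γ] {V : ℕ} (site : Γ → TorusSite 2 V) (W : GrassmannAlgebra 𝕜 Γ)
    {Λ : ℝ} (hΛ : 0 ≤ Λ) (k : ℕ) (p : Fin k) (y : Γ) (i : Fin k) (D : ℕ) {N : ℝ}
    (h : ∑ Y ∈ univ.filter (fun Y : Fin k → Γ => Y p = y),
      ‖kernel 𝕜 W k Y‖ * (1 + labelDiam (fun Y₁ Y₂ : Γ => Λ * (Torus.tnorm (site Y₁ - site Y₂) : ℝ)) (univ.image Y)) ≤ N) :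
    ∑ Y ∈ univ.filter (fun Y : Fin k → Γ => Y p = y ∧ D < Torus.tnorm (site (Y p) - site (Y i))), ‖kernel 𝕜 W k Y‖ ≤
      (1 + Λ * ((D : ℝ) + 1))⁻¹ * N := by
  classical
  have hD : (0 : ℝ) < 1 + Λ * ((D : ℝ) + 1) := by positivity
  have hsplit : univ.filter (fun Y : Fin k → Γ => Y p = y ∧ D < Torus.tnorm (site (Y p) - site (Y i))) =
      (univ.filter (fun Y : Fin k → Γ => Y p = y)).filter (fun Y => D < Torus.tnorm (site (Y p) - site (Y i))) := by
    rw [filter_filter]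
  rw [hsplit]
  have hM := sum_filter_lt_le_inv_mul_sum_scaled (univ.filter (fun Y : Fin k → Γ => Y p = y)) (fun Y => ‖kernel 𝕜 W k Y‖)
    (fun Y => Torus.tnorm (site (Y p) - site (Y i))) (fun _ _ => norm_nonneg _) hΛ D
  refine hM.trans (mul_le_mul_of_nonneg_left (le_trans (sum_le_sum fun Y _ => ?_) h) (inv_nonneg.2 hD.le))
  refine mul_le_mul_of_nonneg_left (add_le_add_right ?_ 1) (norm_nonneg _)
  exact le_labelDiam (fun Y₁ Y₂ : Γ => Λ * (Torus.tnorm (site Y₁ - site Y₂) : ℝ)) (mem_image_of_mem _ (mem_univ p)) (mem_image_of_mem _ (mem_univ i))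

end Profiles

end Summit.HubbardSuperconductivity.HubbardSuperconductivity.Theorems.TwoVolumeDefect

end
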